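import Literature.MathematicalPhysics.QuantumFieldTheory.Balaban1983to89.B1Eq324BenfattoMarkov
import HarnessLib

/-!
# `Balaban1983to89.B1Eq324BenfattoKernelRegression` — [BenfattoEtAl1978] p. 152 «P̂₀(dz|(z̄_Δ)_{Δ∈C})» and Appendix C 2) (C.6) p. 164 FOR A
# GENERAL COVARIANCE KERNEL: the conditional covariance `C^C` of ANY positive-semidefinite kernel is a positive-semidefinite KERNEL (the
# representer identity for its quadratic form) — so the conditioned Gaussian field of the class exists — plus the linear plumbing of the
# regression mean, PROVED

statement-level skeleton of published theorems with citation tags; proofs where landed; nothing here is a claim about the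
Yang–Mills mass gap

WHY THIS MODULE (cell `pub-ymgap`, seat `dag-n08-d` gen 11, INTENT-45 as shrunk by DECL-DELTA-45; node N08 [Balaban1985UV3]; the
[BenfattoEtAl1978] source chain behind the (α)-row `h324`).  With `…Sect5BasicLemma.basicLemmaPrinted_holds` (p591044) the Lemma of p. 152 is a
tree theorem FOR THE FREE FIELD (1.1) (`P0 d α β`, covariance `freeCov d α β = (β(−Δ + α²))⁻¹`).  T. Bałaban uses it ([Balaban1982Higgs1] p. 616,
quoted by [Balaban1985UV3] (24)/(58)) for his own fluctuation covariances with the words *"all the assumptions are satisfied"*: the METHOD of §5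
is applied to a CLASS of Gaussian lattice fields, not to (1.1) itself (located readings `pub-ymgap-dag-n08-w4/N08-IDENT-BRIDGE-NOTE.md`,
`pub-ymgap-dag-n08-c/N08-BASICLEMMA-KERNEL-CENSUS.md`).  The conditioning DICTIONARY of the tree is already kernel-generic
(`B1Eq324BenfattoLemma.condMean G C`, `condCov G C` for any `G : Q₀ → Q₀ → ℝ`); the one structural fact needed before the conditioned field of a
general kernel can even be FORMED as a measure — that `C^C = condCov K C` is again a positive-semidefinite kernel, for EVERY finite window
(including windows meeting `C`) — was proved for `freeCov` only (`…AppendixCLemma2.isPosSemidefKernel_condCov_freeCov`).  This file proves it for an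
ARBITRARY positive-semidefinite `K` with `K_CC` invertible, by the representer identity for the quadratic form of `C^C`.  Companion (seat n08-c,
same day): `…B1Eq324BenfattoCondKernelGeneric` — strict positivity `posDef_covGram_condCov_of_posDef` and the two-stage identities
`condCov_union_eq_of_posDef` / `condMean_union_eq_of_posDef` for a general kernel (by normal equations); nothing of it is restated here.

THE PRINTED STATEMENTS (p. 152 and Appendix C 2) p. 164, cf. the headers of `…B1Eq324BenfattoLemma`, `…Markov`):
*"P̄(dz) is obtained by considering the z_Δ's, Δ ∈ Q₀, as random variables with the conditional distribution P̂₀(dz|(z̄_Δ)_{Δ∈C})"* (p. 152);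
*"the conditioned variables (z_Δ)_{Δ∉Γ} are a non centered gaussian field with covariance C^Γ_{ΔΔ′} … and center u_Δ … C^Γ_{Δ,Δ′} is the
covariance with “Dirichelet boundary condition” on Γ"* (C.6)–(C.7) p. 164.

WHAT IS PROVED (standard axioms; no `sorry`; no definition).  `K : Q₀ → Q₀ → ℝ` a kernel, `C ⊂ Q₀` finite, `K_CC = covGram K C`,
`C^C = condCov K C`, `u_C(w) = condMean K C w`.
* §0 plumbing (generic `K`): `condCov_eq_sub_sum_weight_mul` (`C^C(x,y) = K(x,y) − Σ_{c′} w_x(c′)K(c′,y)`), `condMean_sub`, `condMean_finset_sum_mul`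
  (linearity in the data), `condMean_congr` (only `w|_C` enters), `condMean_col` (`u_C(K(·,y))(x) = K(x,y) − C^C(x,y)`).
* §1 ★★ `isPosSemidefKernel_condCov` — for a positive-semidefinite `K` with `K_CC` invertible, `C^C` is a positive-semidefinite kernel, so the
  conditioned Gaussian field of `K` EXISTS as `gaussianFieldOfKernel (condCov K C)` shifted by `u_C`; via the representer identity
  `Σ_{x,y∈I} v_x v_y C^C(x,y) = F_vᵀ K_{SS} F_v`, `S = I ∪ C`, `F_v = v − (regression weights of v on C)` (private `exists_rep_quadForm_eq`, which
  also records `F_v = v` off `C` — the form from which strict positivity off `C` follows).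

HONEST SCOPE.  Kernel-generic linear algebra of Gaussian regression; no measure here (the conditioned field of `K` as a Gaussian MEASURE, the
independence of box fields where `C^Γ` vanishes, the tower identity (5.13) and the two-stage disintegration for `K` are the sequel
`…B1Eq324BenfattoKernelCondField`); the class HYPOTHESES of a generalised Basic Lemma (finite-range Markov vanishing of `C^Γ`, (C.6)–(C.9)-type
decay) and that lemma itself are NOT stated or proved here; nothing of [Balaban1985UV3] / [Balaban1985UV2] is asserted; count-neutral for N08;
nothing about d = 4, the continuum, OS axioms, a mass gap or the Clay problem.
-/

noncomputable section

open Finset Matrix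
open scoped BigOperators Matrix

namespace Literature.MathematicalPhysics.QuantumFieldTheory.Balaban1983to89.B1Eq324BenfattoKernelRegression

open Literature.MathematicalPhysics.QuantumFieldTheory
open Literature.MathematicalPhysics.QuantumFieldTheory.Balaban1983to89.B1Eq324BenfattoLemma
open Literature.MathematicalPhysics.QuantumFieldTheory.Balaban1983to89.B1Eq324BenfattoCondCentre
open Literature.MathematicalPhysics.QuantumFieldTheory.Balaban1983to89.B1Eq324BenfattoAppendixC2
open Literature.MathematicalPhysics.QuantumFieldTheory.Balaban1983to89.B1Eq324BenfattoMarkov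

variable {d : ℕ}

/-! ## §0  Plumbing: the regression objects for a general kernel -/

section Plumbing

variable (K : B1Eq324BenfattoLemma.Site d → B1Eq324BenfattoLemma.Site d → ℝ) (C : Finset (B1Eq324BenfattoLemma.Site d))

/-- **`C^C(x, y) = K(x, y) − Σ_{c′∈C} w_x(c′) K(c′, y)`** with the regression weights `w_x(c′) = Σ_{c∈C} K(x,c)(K_CC)⁻¹_{cc′}`: the conditional
covariance is the kernel minus the regression of the column `K(·, y)`. [cite: BenfattoEtAl1978, Appendix C 2) (C.6)–(C.7) p.164] -/
theorem condCov_eq_sub_sum_weight_mul (x y : B1Eq324BenfattoLemma.Site d) :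
    condCov K C x y = K x y - ∑ c' : C, (∑ c : C, K x c * (covGram K C)⁻¹ c c') * K c' y := by
  simp only [condCov]
  congr 1
  rw [Finset.sum_comm]
  exact Finset.sum_congr rfl fun c' _ => by rw [Finset.sum_mul]

/-- The regression mean is additive in the data: `u_C(w − w′) = u_C(w) − u_C(w′)`. [cite: BenfattoEtAl1978, Appendix C 2) (C.7) p.164] -/
theorem condMean_sub (w w' : B1Eq324BenfattoLemma.Site d → ℝ) (x : B1Eq324BenfattoLemma.Site d) :
    condMean K C (fun z => w z - w' z) x = condMean K C w x - condMean K C w' x := by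
  simp only [condMean, mul_sub, Finset.sum_sub_distrib]

/-- The regression mean is linear in the data: `u_C(Σ_i a_i f_i) = Σ_i a_i u_C(f_i)`. [cite: BenfattoEtAl1978, Appendix C 2) (C.7) p.164] -/
theorem condMean_finset_sum_mul {ι : Type*} (s : Finset ι) (a : ι → ℝ) (f : ι → B1Eq324BenfattoLemma.Site d → ℝ)
    (x : B1Eq324BenfattoLemma.Site d) :
    condMean K C (fun z => ∑ i ∈ s, a i * f i z) x = ∑ i ∈ s, a i * condMean K C (f i) x := by
  calc condMean K C (fun z => ∑ i ∈ s, a i * f i z) x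
      = ∑ c : C, ∑ c' : C, ∑ i ∈ s, a i * (K x c * (covGram K C)⁻¹ c c' * f i c') := by
        simp only [condMean, Finset.mul_sum]
        exact Finset.sum_congr rfl fun c _ => Finset.sum_congr rfl fun c' _ => Finset.sum_congr rfl fun i _ => by ring
    _ = ∑ c : C, ∑ i ∈ s, ∑ c' : C, a i * (K x c * (covGram K C)⁻¹ c c' * f i c') :=
        Finset.sum_congr rfl fun c _ => Finset.sum_comm
    _ = ∑ i ∈ s, ∑ c : C, ∑ c' : C, a i * (K x c * (covGram K C)⁻¹ c c' * f i c') := Finset.sum_comm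
    _ = ∑ i ∈ s, a i * condMean K C (f i) x := by
        simp only [condMean, Finset.mul_sum]

/-- Only the values of the data on `C` enter the regression mean. [cite: BenfattoEtAl1978, p.152 «P̂₀(dz|(z̄_Δ)_{Δ∈C})»] -/
theorem condMean_congr {w w' : B1Eq324BenfattoLemma.Site d → ℝ} (h : ∀ c ∈ C, w c = w' c) (x : B1Eq324BenfattoLemma.Site d) :
    condMean K C w x = condMean K C w' x := by
  simp only [condMean]
  exact Finset.sum_congr rfl fun c _ => Finset.sum_congr rfl fun c' _ => by rw [h c' c'.2]

/-- **The regression of a column**: `u_C(K(·, y))(x) = K(x, y) − C^C(x, y)`. [cite: BenfattoEtAl1978, Appendix C 2) (C.6)–(C.7) p.164] -/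
theorem condMean_col (x y : B1Eq324BenfattoLemma.Site d) :
    condMean K C (fun z => K z y) x = K x y - condCov K C x y := by
  rw [condCov_eq_sub_condMean]
  ring

end Plumbing

/-! ## §1  `C^C` is a positive semidefinite kernel -/

section Positivity

variable (K : B1Eq324BenfattoLemma.Site d → B1Eq324BenfattoLemma.Site d → ℝ)

/-- kernel: restricting a sum over `↥S` against a function supported on `T ⊆ S` to a sum over `↥T`. [folklore] -/
private theorem sum_mul_dite_eq {S T : Finset (B1Eq324BenfattoLemma.Site d)} (hTS : T ⊆ S) (g : B1Eq324BenfattoLemma.Site d → ℝ)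
    (u : T → ℝ) :
    ∑ s : S, g s * (if h : (s : B1Eq324BenfattoLemma.Site d) ∈ T then u ⟨s, h⟩ else 0) = ∑ t : T, g t * u t := by
  classical
  set φ : B1Eq324BenfattoLemma.Site d → ℝ := fun a => g a * (if h : a ∈ T then u ⟨a, h⟩ else 0) with hφ
  calc ∑ s : S, g s * (if h : (s : B1Eq324BenfattoLemma.Site d) ∈ T then u ⟨s, h⟩ else 0)
      = ∑ a ∈ S, φ a := Finset.sum_coe_sort S φ
    _ = ∑ a ∈ T, φ a := (Finset.sum_subset hTS fun a _ haT => by simp [hφ, haT]).symm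
    _ = ∑ t : T, φ t := (Finset.sum_coe_sort T φ).symm
    _ = ∑ t : T, g t * u t := Finset.sum_congr rfl fun t _ => by simp [hφ, t.2]

/-- **The representer identity for the quadratic form of `C^C`**: for a symmetric kernel with `K_CC` invertible, a finite window `I` and
coefficients `v`, there is a vector `F` on `S = I ∪ C` — the coefficients `v` corrected on `C` by the regression weights — with
`Σ_{x,y∈I} v_x v_y C^C(x,y) = Fᵀ K_SS F`, and `F = v` off `C`. [cite: BenfattoEtAl1978, Appendix C 2) (C.6) p.164] -/
private theorem exists_rep_quadForm_eq (hK : ∀ x y, K x y = K y x) (C I : Finset (B1Eq324BenfattoLemma.Site d))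
    (hC : IsUnit (covGram K C).det) (v : I → ℝ) :
    ∃ F : ↥(I ∪ C) → ℝ,
      (∀ s : ↥(I ∪ C), (s : B1Eq324BenfattoLemma.Site d) ∉ C →
          F s = if h : (s : B1Eq324BenfattoLemma.Site d) ∈ I then v ⟨s, h⟩ else 0) ∧
        ∑ x : I, ∑ y : I, v x * v y * condCov K C x y = F ⬝ᵥ (covGram K (I ∪ C) *ᵥ F) := by
  classical
  set S := I ∪ C with hS
  have hIS : I ⊆ S := Finset.subset_union_left
  have hCS : C ⊆ S := Finset.subset_union_right
  -- regression weights of the test sites and the two pieces of the representer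
  set a : I → C → ℝ := fun x c' => ∑ c : C, K x c * (covGram K C)⁻¹ c c' with ha
  set vt : B1Eq324BenfattoLemma.Site d → ℝ := fun s => if h : s ∈ I then v ⟨s, h⟩ else 0 with hvt
  set at' : B1Eq324BenfattoLemma.Site d → ℝ := fun s => if h : s ∈ C then ∑ x : I, v x * a x ⟨s, h⟩ else 0 with hat
  refine ⟨fun s => vt s - at' s, fun s hs => by simp [hvt, hat, hs], ?_⟩
  -- Step 1: `(K_SS F)(s) = Σ_x v_x C^C(x, s)`
  have hKF : ∀ s : S, (covGram K S *ᵥ fun t : S => vt t - at' t) s = ∑ x : I, v x * condCov K C x s := by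
    intro s
    have h1 : ∑ t : S, K s t * vt t = ∑ x : I, K s x * v x := sum_mul_dite_eq hIS (fun t => K s t) v
    have h2 : ∑ t : S, K s t * at' t = ∑ c' : C, K s c' * ∑ x : I, v x * a x c' :=
      sum_mul_dite_eq hCS (fun t => K s t) fun c' => ∑ x : I, v x * a x c'
    calc (covGram K S *ᵥ fun t : S => vt t - at' t) s
        = ∑ t : S, K s t * vt t - ∑ t : S, K s t * at' t := by
          simp only [Matrix.mulVec, dotProduct, covGram_apply, mul_sub, Finset.sum_sub_distrib]
      _ = ∑ x : I, K s x * v x - ∑ x : I, v x * ∑ c' : C, a x c' * K s c' := by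
          rw [h1, h2]
          congr 1
          calc ∑ c' : C, K s c' * ∑ x : I, v x * a x c'
              = ∑ c' : C, ∑ x : I, v x * (a x c' * K s c') := by
                refine Finset.sum_congr rfl fun c' _ => ?_
                rw [Finset.mul_sum]
                exact Finset.sum_congr rfl fun x _ => by ring
            _ = ∑ x : I, ∑ c' : C, v x * (a x c' * K s c') := Finset.sum_comm
            _ = ∑ x : I, v x * ∑ c' : C, a x c' * K s c' :=
                Finset.sum_congr rfl fun x _ => by rw [Finset.mul_sum]
      _ = ∑ x : I, v x * condCov K C x s := by
          rw [← Finset.sum_sub_distrib]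
          refine Finset.sum_congr rfl fun x _ => ?_
          rw [condCov_eq_sub_sum_weight_mul, hK (s : B1Eq324BenfattoLemma.Site d) x]
          have : ∑ c' : C, a x c' * K s c' = ∑ c' : C, a x c' * K c' s :=
            Finset.sum_congr rfl fun c' _ => by rw [hK (s : B1Eq324BenfattoLemma.Site d) c']
          rw [this]
          ring
  -- Step 2: pair with `F`; the correction part pairs to `0` because `C^C(x, ·)` vanishes on `C`
  have hat0 : ∀ s : S, at' s * ∑ x : I, v x * condCov K C x s = 0 := by
    intro s
    by_cases hs : (s : B1Eq324BenfattoLemma.Site d) ∈ C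
    · have : ∑ x : I, v x * condCov K C x s = 0 :=
        Finset.sum_eq_zero fun x _ => by rw [condCov_of_mem_right hK C hC _ hs, mul_zero]
      rw [this, mul_zero]
    · simp [hat, hs]
  calc ∑ x : I, ∑ y : I, v x * v y * condCov K C x y
      = ∑ y : I, (∑ x : I, v x * condCov K C x y) * v y := by
        rw [Finset.sum_comm]
        refine Finset.sum_congr rfl fun y _ => ?_
        rw [Finset.sum_mul]
        exact Finset.sum_congr rfl fun x _ => by ring
    _ = ∑ s : S, (∑ x : I, v x * condCov K C x s) * vt s := by
        simp only [hvt]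
        exact (sum_mul_dite_eq hIS (fun s => ∑ x : I, v x * condCov K C x s) v).symm
    _ = ∑ s : S, (vt s - at' s) * ∑ x : I, v x * condCov K C x s := by
        refine Finset.sum_congr rfl fun s _ => ?_
        rw [sub_mul, hat0 s, sub_zero, mul_comm]
    _ = (fun s : S => vt s - at' s) ⬝ᵥ (covGram K S *ᵥ fun t : S => vt t - at' t) := by
        simp only [dotProduct]
        exact Finset.sum_congr rfl fun s _ => by rw [hKF s]

/-- **`C^C` IS A POSITIVE SEMIDEFINITE KERNEL** for every positive-semidefinite kernel `K` whose Gram matrix on the conditioning set `C` is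
invertible: `Σ_{x,y} v_x v_y C^C(x,y) = Fᵀ K_SS F ≥ 0`.  Hence the conditioned Gaussian field of `K` given `z_C` — covariance `C^C`
«with Dirichlet boundary condition on C», centre `u_C(z̄)` — exists for the whole class (the `freeCov` instance is
`…AppendixCLemma2.isPosSemidefKernel_condCov_freeCov`). [cite: BenfattoEtAl1978, Appendix C 2) (C.6) p.164] -/
theorem isPosSemidefKernel_condCov (hKp : IsPosSemidefKernel K) (C : Finset (B1Eq324BenfattoLemma.Site d))
    (hC : IsUnit (covGram K C).det) : IsPosSemidefKernel (condCov K C) := by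
  classical
  have hK : ∀ x y, K x y = K y x := fun x y => B3WTFreeMeasure.kernel_comm hKp x y
  intro I
  refine Matrix.PosSemidef.of_dotProduct_mulVec_nonneg (Matrix.IsHermitian.ext fun s t => ?_) fun v => ?_
  · simp only [covGram_apply, star_trivial]
    exact condCov_comm hK C _ _
  · rw [star_trivial]
    obtain ⟨F, -, hF⟩ := exists_rep_quadForm_eq K hK C I hC v
    have hq : v ⬝ᵥ (covGram (condCov K C) I *ᵥ v) = ∑ x : I, ∑ y : I, v x * v y * condCov K C x y := by
      simp only [dotProduct, Matrix.mulVec, covGram_apply, Finset.mul_sum]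
      exact Finset.sum_congr rfl fun x _ => Finset.sum_congr rfl fun y _ => by ring
    rw [hq, hF]
    have := (hKp (I ∪ C)).dotProduct_mulVec_nonneg F
    rwa [star_trivial] at this

end Positivity

end Literature.MathematicalPhysics.QuantumFieldTheory.Balaban1983to89.B1Eq324BenfattoKernelRegression

end
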